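import Mathlib

/-!
# The momentum-side endpoint devil is algebraically absorbable (symbol identity, flat principal part)

Bookkeeping for crux `ExactKerrEnds.TameEscapeToKerrEnds` (stmt-FinalStateConjecture-18522), atom (b) of
`stub_matchedKerrGluingFamily`: in the momentum constraint `Φ_{M,i} = g^{jl}∂_j k_{il} − ∂_i(g^{jl}k_{jl}) + Γ⋆k`
of a member `g = h_d + w`, `k = k_d + Q` (`w` = small `C²`-sup field, `k_d` with ONE sup-derivative and no modulus),
the ROUGH terms linear in `w` (those where the derivative falls on `k_d`; `J_{l,ij} := ∂_l k_{d,ij}`) are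
`T1 = −w^{jl}J_{j,il}`, `T2 = +w^{jl}J_{i,jl}` (from `g⁻¹ = δ − w`), and, for the SYMMETRIC algebraic dressing
`Q := w k + k w − (tr k) w − ½ (w:k) δ + ½ (tr w)(tr k) δ`, the rough parts `T3 = (∂_j Q_{ij})_rough`,
`T4 = −(∂_i tr Q)_rough`.  CLAIM (flat principal symbol, first order in `w`):
`T1 + T2 + T3 + T4 = Σ_m w_{im} 𝒞_m` with `𝒞_m := Σ_j J_{j,mj} − Σ_n J_{m,nn}` = the rough part of `d`'s OWN momentum
constraint `(div k − d tr k)_m`, which is TAME (= `−Γ⋆k`, one sup-derivative).  So no antisymmetric-commutator residual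
survives (contra STRATEGY-CENSUS §Negation, refinement, and the addendum of `Ideas/devils-staircase-curvature.md`):
the momentum-side devil is exactly absorbable; the decisive endpoint object is on the Hamiltonian side.
Proved below for all symmetric `w` and all symmetric jets `J_0, J_1, J_2` by brute-force expansion over `Fin 3`.
-/

open Matrix BigOperators

namespace MomentumDressing

/-- A symmetric `3 × 3` real matrix from its six free entries. -/
def S3 (a b c d e f : ℝ) : Matrix (Fin 3) (Fin 3) ℝ := !![a, b, c; b, d, e; c, e, f]

/-- **The dressing identity.** `T1 + T2 + T3 + T4 = Σ_m w_{im} 𝒞_m` for every `i`. -/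
theorem dressing_identity
    (w00 w01 w02 w11 w12 w22 : ℝ)
    (x00 x01 x02 x11 x12 x22 : ℝ)
    (y00 y01 y02 y11 y12 y22 : ℝ)
    (z00 z01 z02 z11 z12 z22 : ℝ) (i : Fin 3) :
    let w : Matrix (Fin 3) (Fin 3) ℝ := S3 w00 w01 w02 w11 w12 w22
    let J : Fin 3 → Matrix (Fin 3) (Fin 3) ℝ :=
      ![S3 x00 x01 x02 x11 x12 x22, S3 y00 y01 y02 y11 y12 y22, S3 z00 z01 z02 z11 z12 z22]
    (-(∑ j, ∑ l, w j l * J j i l)) + (∑ j, ∑ l, w j l * J i j l)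
      + ((∑ j, (w * J j + J j * w - (J j).trace • w) i j)
          - (1 / 2) * (∑ m, ∑ n, w m n * J i m n) + (1 / 2) * w.trace * (J i).trace)
      - ((1 / 2) * (∑ m, ∑ n, w m n * J i m n) + (1 / 2) * w.trace * (J i).trace)
    = ∑ m, w i m * ((∑ j, J j m j) - (J m).trace) := by
  intro w J
  fin_cases i <;>
    simp [w, J, S3, Matrix.trace, Matrix.mul_apply, Fin.sum_univ_three, Matrix.smul_apply,
      Matrix.sub_apply, Matrix.add_apply] <;>
    ring

end MomentumDressing
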